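import Summits.HubbardSuperconductivity.HubbardSuperconductivity.Theses.BalabanIR

/-!
# The witness table against `BalabanIR.BirComplexStableXY` (stmt-HubbardSuperconductivity-2080) — definitions

Helper file of the NEGATIVE lane for crux `BirComplexStableXY` (route BalabanIR, the "engine": positivity-free
control of COMPLEX coercive `U(1)`-invariant window actions on `(ℤ/L)² × ℤ/M`, uniformly in `L₀ ≤ L ≤ M`).
It names the crux's own sub-expressions (`genF` = the local generating function `F`, `sh` = the window shift,
`action`, `cube`, `partZ` = `Z`), defines the WITNESS TABLE `witness ε₁ ε₂` (window `r = 2`; the twelve cube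
edges; temporal stiffness `1 + iε₁`, Berry-like time-odd term `iε₂ sin ∂_τθ`) from the building blocks
`cosTab u v` (`1 − cos(φ_u − φ_v)`) and `sinTab u v` (`sin(φ_u − φ_v)`), and proves the evaluation /
linearity lemmas for the four hypothesis functionals of the crux ((U1) charge neutrality of the support,
(N) `Σ c_n = 0`, (A) the `e^{|n|₁}`-weighted `ℓ¹` norm, and `F` itself for (C)).  The admissibility of the
witness and the negative lemma `WitnessZeroExists → ¬ BirComplexStableXY` are in
`BirComplexStableXYFalseOfWitnessZeroExists.lean`.  Everything here is elementary `Finsupp` bookkeeping.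
Standing disprover refuter-cdisprove-stmt-HubbardSuperconductivity-2080-0, 2026-08-16 (work file with the full
analysis: `Cruxes/BirComplexStableXY/Disproof.lean`).
-/

namespace Summit.HubbardSuperconductivity.BirComplexStableXYNegative

open scoped BigOperators
open MeasureTheory Literature.Probability.LatticeModels
open Summit.HubbardSuperconductivity.HubbardSuperconductivity.Theses.BalabanIR

noncomputable section

/-! ## Named pieces of the crux (verbatim sub-expressions of `BirComplexStableXY`) -/

/-- window of side `r` (two spatial coordinates, one temporal). -/
abbrev W (r : ℕ) : Type := Fin r × Fin r × Fin r
/-- Fourier frequencies on the window. -/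
abbrev Freq (r : ℕ) : Type := W r → ℤ
/-- finitely supported Fourier tables. -/
abbrev Table (r : ℕ) : Type := Freq r →₀ ℂ
/-- space-time torus `(ℤ/L)² × ℤ/M`. -/
abbrev Λ (L M : ℕ) : Type := TorusSite 2 L × ZMod M

/-- the local generating function `F(φ) = Σ_n c_n e^{i n·φ}` (verbatim the crux's `F`). -/
def genF {r : ℕ} (c : Table r) (φ : W r → ℝ) : ℂ :=
  c.sum (fun n a => a * Complex.exp (Complex.I * ((∑ w, (n w : ℝ) * φ w : ℝ) : ℂ)))

/-- window shift (verbatim the crux's `sh`). -/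
def sh {r : ℕ} (L M : ℕ) (s : Λ L M) (w : W r) : Λ L M :=
  (s.1 + ![((w.1 : ℕ) : ZMod L), ((w.2.1 : ℕ) : ZMod L)], s.2 + ((w.2.2 : ℕ) : ZMod M))

/-- the action `A(θ) = K Σ_s F(θ ∘ sh s)`. -/
def action {r : ℕ} (K : ℝ) (c : Table r) (L M : ℕ) [NeZero L] [NeZero M] (θ : Λ L M → ℝ) : ℂ :=
  (K : ℂ) * ∑ s : Λ L M, genF c (fun w => θ (sh L M s w))

/-- the cube `[0,2π]^Λ`. -/
def cube (L M : ℕ) : Set (Λ L M → ℝ) := Set.pi Set.univ (fun _ => Set.Icc (0:ℝ) (2 * Real.pi))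

/-- the complex partition function `Z = ∫_cube e^{-A}`. -/
def partZ {r : ℕ} (K : ℝ) (c : Table r) (L M : ℕ) [NeZero L] [NeZero M] : ℂ :=
  MeasureTheory.integral (MeasureTheory.volume.restrict (cube L M))
    (fun θ => Complex.exp (-(action K c L M θ)))


/-- frequency `δ_u − δ_v` of the phase difference `φ_u − φ_v`. -/
def dfreq (u v : W 2) : Freq 2 := Pi.single u 1 - Pi.single v 1

/-- Fourier table of `1 − cos(φ_u − φ_v)`. -/
def cosTab (u v : W 2) : Table 2 :=
  Finsupp.single 0 1 + Finsupp.single (dfreq u v) (-(1/2 : ℂ)) + Finsupp.single (dfreq v u) (-(1/2 : ℂ))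

/-- Fourier table of `sin(φ_u − φ_v) = (e^{i(φ_u−φ_v)} − e^{−i(φ_u−φ_v)})/(2i)`. -/
def sinTab (u v : W 2) : Table 2 :=
  Finsupp.single (dfreq u v) (-(Complex.I / 2)) + Finsupp.single (dfreq v u) (Complex.I / 2)

/-- window vertex `(a, b, t)`. -/
abbrev vx (a b t : Fin 2) : W 2 := (a, b, t)

/-- the eight spatial cube edges as (head, tail) pairs (head = coordinate 1, tail = coordinate 0). -/
def spatialEdges : List (W 2 × W 2) :=
  [(vx 1 0 0, vx 0 0 0), (vx 1 0 1, vx 0 0 1), (vx 1 1 0, vx 0 1 0), (vx 1 1 1, vx 0 1 1),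
   (vx 0 1 0, vx 0 0 0), (vx 0 1 1, vx 0 0 1), (vx 1 1 0, vx 1 0 0), (vx 1 1 1, vx 1 0 1)]

/-- the four temporal cube edges as (later, earlier) pairs. -/
def temporalEdges : List (W 2 × W 2) :=
  [(vx 0 0 1, vx 0 0 0), (vx 0 1 1, vx 0 1 0), (vx 1 0 1, vx 1 0 0), (vx 1 1 1, vx 1 1 0)]

/-- spatial part of the witness: `Σ_{8 spatial edges} (1 − cos Δ_eφ)`. -/
def spatialTab : Table 2 := (spatialEdges.map fun e => cosTab e.1 e.2).sum

/-- temporal cosine part: `Σ_{4 temporal edges} (1 − cos Δ_eφ)`. -/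
def temporalCosTab : Table 2 := (temporalEdges.map fun e => cosTab e.1 e.2).sum

/-- temporal sine (Berry-like, time-odd) part: `Σ_{4 temporal edges} sin Δ_eφ`. -/
def temporalSinTab : Table 2 := (temporalEdges.map fun e => sinTab e.1 e.2).sum

/-- THE WITNESS TABLE `c_{ε₁,ε₂}`. -/
def witness (ε₁ ε₂ : ℝ) : Table 2 :=
  spatialTab + ((1 : ℂ) + Complex.I * ε₁) • temporalCosTab + (Complex.I * ε₂) • temporalSinTab

/-! ### §3a Evaluation lemmas for tables built from `Finsupp.single` -/

section eval
variable {r : ℕ}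

/-- the character `e_n(φ) = exp(i n·φ)`. -/
def ch (n : Freq r) (φ : W r → ℝ) : ℂ := Complex.exp (Complex.I * ((∑ w, (n w : ℝ) * φ w : ℝ) : ℂ))

/-- `F` is additive in the table. -/
theorem genF_add (c₁ c₂ : Table r) (φ : W r → ℝ) : genF (c₁ + c₂) φ = genF c₁ φ + genF c₂ φ := by
  unfold genF
  exact Finsupp.sum_add_index' (fun n => by simp) (fun n a b => by ring)

/-- `F` is homogeneous in the table. -/
theorem genF_smul (b : ℂ) (c : Table r) (φ : W r → ℝ) : genF (b • c) φ = b * genF c φ := by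
  unfold genF
  rw [Finsupp.sum_smul_index' (fun n => by simp), Finsupp.mul_sum]
  simp only [smul_eq_mul, mul_assoc]

/-- `F` of a single Fourier mode is that character. -/
theorem genF_single (n : Freq r) (a : ℂ) (φ : W r → ℝ) :
    genF (Finsupp.single n a) φ = a * ch n φ := by
  unfold genF ch
  rw [Finsupp.sum_single_index]
  simp

/-- total coefficient sum `Σ_n c_n` (hypothesis (N) reads `tsum c = 0`). -/
def tsum (c : Table r) : ℂ := c.sum (fun _ a => a)

/-- (N)'s functional is additive. -/
theorem tsum_add (c₁ c₂ : Table r) : tsum (c₁ + c₂) = tsum c₁ + tsum c₂ :=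
  Finsupp.sum_add_index' (fun _ => rfl) (fun _ _ _ => rfl)

/-- (N)'s functional is homogeneous. -/
theorem tsum_smul (b : ℂ) (c : Table r) : tsum (b • c) = b * tsum c := by
  unfold tsum
  rw [Finsupp.sum_smul_index' (fun _ => rfl), Finsupp.mul_sum]
  simp only [smul_eq_mul]

/-- (N)'s functional on a single mode. -/
theorem tsum_single (n : Freq r) (a : ℂ) : tsum (Finsupp.single n a) = a :=
  Finsupp.sum_single_index rfl

/-- (N)'s functional vanishes on the zero table. -/
theorem tsum_zero : tsum (0 : Table r) = 0 := by simp [tsum]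

/-- the exponentially weighted `ℓ¹` norm of hypothesis (A) (which reads `normA c ≤ B`). -/
def normA (c : Table r) : ℝ := c.sum (fun n a => ‖a‖ * Real.exp (∑ w, |(n w : ℝ)|))

/-- (A)'s weighted norm is subadditive. -/
theorem normA_add_le (c₁ c₂ : Table r) : normA (c₁ + c₂) ≤ normA c₁ + normA c₂ := by
  classical
  unfold normA
  have h0 : ∀ i ∈ c₁.support ∪ c₂.support,
      (fun (n : Freq r) (a : ℂ) => ‖a‖ * Real.exp (∑ w, |(n w : ℝ)|)) i 0 = 0 := fun i _ => by simp
  rw [Finsupp.sum_of_support_subset (c₁ + c₂) Finsupp.support_add _ h0,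
    Finsupp.sum_of_support_subset c₁ Finset.subset_union_left _ h0,
    Finsupp.sum_of_support_subset c₂ Finset.subset_union_right _ h0, ← Finset.sum_add_distrib]
  refine Finset.sum_le_sum fun i _ => ?_
  rw [Finsupp.add_apply, ← add_mul]
  exact mul_le_mul_of_nonneg_right (norm_add_le _ _) (Real.exp_nonneg _)

/-- (A)'s weighted norm is absolutely homogeneous. -/
theorem normA_smul (b : ℂ) (c : Table r) : normA (b • c) = ‖b‖ * normA c := by
  unfold normA
  rw [Finsupp.sum_smul_index' (fun _ => by simp), Finsupp.mul_sum]
  simp only [smul_eq_mul, norm_mul, mul_assoc]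

/-- (A)'s weighted norm of a single mode. -/
theorem normA_single (n : Freq r) (a : ℂ) :
    normA (Finsupp.single n a) = ‖a‖ * Real.exp (∑ w, |(n w : ℝ)|) := by
  unfold normA
  exact Finsupp.sum_single_index (by simp)

/-- (A)'s weighted norm is non-negative. -/
theorem normA_nonneg (c : Table r) : 0 ≤ normA c :=
  Finset.sum_nonneg fun _ _ => mul_nonneg (norm_nonneg _) (Real.exp_nonneg _)

/-- (A)'s weighted norm of the zero table. -/
theorem normA_zero : normA (0 : Table r) = 0 := by simp [normA]

/-- (U1) is preserved by sums. -/
theorem condU1_add {c₁ c₂ : Table r} (h₁ : (∀ m ∈ (c₁).support, ∑ w, m w = 0)) (h₂ : (∀ m ∈ (c₂).support, ∑ w, m w = 0)) :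
    (∀ m ∈ (c₁ + c₂).support, ∑ w, m w = 0) := by
  classical
  intro n hn
  rcases Finset.mem_union.1 (Finsupp.support_add hn) with h | h
  exacts [h₁ n h, h₂ n h]

/-- (U1) is preserved by scalar multiples. -/
theorem condU1_smul (b : ℂ) {c : Table r} (h : (∀ m ∈ (c).support, ∑ w, m w = 0)) :
    (∀ m ∈ (b • c).support, ∑ w, m w = 0) :=
  fun n hn => h n (Finsupp.support_smul hn)

/-- (U1) holds for a single charge-neutral mode. -/
theorem condU1_single {n : Freq r} (hn : ∑ w, n w = 0) (a : ℂ) :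
    (∀ m ∈ (Finsupp.single n a).support, ∑ w, m w = 0) := by
  intro m hm
  have := Finsupp.support_single_subset hm
  rw [Finset.mem_singleton] at this
  subst this
  exact hn

/-- `F` of the zero table vanishes. -/
theorem genF_zero (φ : W r → ℝ) : genF (0 : Table r) φ = 0 := by simp [genF]

/-- `F` of a list sum of tables. -/
theorem genF_list_sum (l : List (Table r)) (φ : W r → ℝ) :
    genF l.sum φ = (l.map fun c => genF c φ).sum := by
  induction l with
  | nil => simp [genF_zero]
  | cons a l ih => simp [List.sum_cons, genF_add, ih]

/-- (N)'s functional of a list sum of tables. -/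
theorem tsum_list_sum (l : List (Table r)) : tsum l.sum = (l.map tsum).sum := by
  induction l with
  | nil => simp [tsum]
  | cons a l ih => simp [List.sum_cons, tsum_add, ih]

/-- (A)'s weighted norm of a list sum of tables. -/
theorem normA_list_sum_le (l : List (Table r)) : normA l.sum ≤ (l.map normA).sum := by
  induction l with
  | nil => simp [normA]
  | cons a l ih => simpa [List.sum_cons] using (normA_add_le a l.sum).trans (by linarith)

/-- (U1) holds for the zero table. -/
theorem condU1_zero : (∀ m ∈ ((0 : Table r)).support, ∑ w, m w = 0) := fun n hn => by simp at hn

/-- (U1) is preserved by list sums. -/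
theorem condU1_list_sum (l : List (Table r)) (h : ∀ c ∈ l, (∀ m ∈ (c).support, ∑ w, m w = 0)) :
    (∀ m ∈ (l.sum).support, ∑ w, m w = 0) := by
  induction l with
  | nil => rw [List.sum_nil]; exact condU1_zero
  | cons a l ih =>
    rw [List.sum_cons]
    exact condU1_add (h a (by simp)) (ih fun c hc => h c (by simp [hc]))

end eval

/-! ### §3b The building blocks evaluate to `1 − cos` and `sin` -/

/-- the trivial character is `1`. -/
theorem ch_zero (φ : W 2 → ℝ) : ch (0 : Freq 2) φ = 1 := by simp [ch]

/-- `(δ_u − δ_v)·φ = φ_u − φ_v`. -/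
theorem sum_dfreq_mul (u v : W 2) (φ : W 2 → ℝ) :
    (∑ w, ((dfreq u v w : ℤ) : ℝ) * φ w) = φ u - φ v := by
  simp [dfreq, Pi.single_apply, sub_mul, Finset.sum_sub_distrib]

/-- the character of `δ_u − δ_v` is `e^{i(φ_u − φ_v)}`. -/
theorem ch_dfreq (u v : W 2) (φ : W 2 → ℝ) :
    ch (dfreq u v) φ = Complex.exp (Complex.I * ((φ u - φ v : ℝ) : ℂ)) := by
  rw [ch, sum_dfreq_mul]

/-- `δ_u − δ_v` is charge neutral. -/
theorem sum_dfreq (u v : W 2) : ∑ w, dfreq u v w = 0 := by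
  simp [dfreq, Finset.sum_sub_distrib]

/-- `|δ_u − δ_v|₁ = 2` for `u ≠ v`. -/
theorem sum_abs_dfreq {u v : W 2} (h : u ≠ v) : (∑ w, |((dfreq u v w : ℤ) : ℝ)|) = 2 := by
  have key : ∀ w, |((dfreq u v w : ℤ) : ℝ)| = (if w = u then 1 else 0) + (if w = v then 1 else 0) := by
    intro w
    by_cases hu : w = u
    · subst hu; simp [dfreq, h]
    · by_cases hv : w = v
      · subst hv; simp [dfreq, hu]
      · simp [dfreq, hu, hv]
  simp_rw [key]
  rw [Finset.sum_add_distrib, Finset.sum_ite_eq', Finset.sum_ite_eq']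
  simp; norm_num

/-- `F(cosTab u v) = 1 − cos(φ_u − φ_v)`. -/
theorem genF_cosTab (u v : W 2) (φ : W 2 → ℝ) :
    genF (cosTab u v) φ = ((1 - Real.cos (φ u - φ v) : ℝ) : ℂ) := by
  have e1 : ch (dfreq u v) φ = Complex.exp (((φ u - φ v : ℝ) : ℂ) * Complex.I) := by
    rw [ch_dfreq, mul_comm]
  have e2 : ch (dfreq v u) φ = Complex.exp (-((φ u - φ v : ℝ) : ℂ) * Complex.I) := by
    rw [ch_dfreq]; congr 1; push_cast; ring
  have h2 := Complex.two_cos ((φ u - φ v : ℝ) : ℂ)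
  simp only [cosTab, genF_add, genF_single, ch_zero, e1, e2]
  push_cast at h2 ⊢
  linear_combination (1/2 : ℂ) * h2

/-- `F(sinTab u v) = sin(φ_u − φ_v)`. -/
theorem genF_sinTab (u v : W 2) (φ : W 2 → ℝ) :
    genF (sinTab u v) φ = ((Real.sin (φ u - φ v) : ℝ) : ℂ) := by
  have e1 : ch (dfreq u v) φ = Complex.exp (((φ u - φ v : ℝ) : ℂ) * Complex.I) := by
    rw [ch_dfreq, mul_comm]
  have e2 : ch (dfreq v u) φ = Complex.exp (-((φ u - φ v : ℝ) : ℂ) * Complex.I) := by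
    rw [ch_dfreq]; congr 1; push_cast; ring
  have h2 := Complex.two_sin ((φ u - φ v : ℝ) : ℂ)
  simp only [sinTab, genF_add, genF_single, e1, e2]
  push_cast at h2 ⊢
  linear_combination (-1/2 : ℂ) * h2

/-- `cosTab` vanishes at constants ((N)). -/
theorem tsum_cosTab (u v : W 2) : tsum (cosTab u v) = 0 := by
  simp only [cosTab, tsum_add, tsum_single]; norm_num

/-- `sinTab` vanishes at constants ((N)). -/
theorem tsum_sinTab (u v : W 2) : tsum (sinTab u v) = 0 := by
  simp only [sinTab, tsum_add, tsum_single]; ring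

/-- `cosTab` is `U(1)` invariant. -/
theorem condU1_cosTab (u v : W 2) : (∀ m ∈ (cosTab u v).support, ∑ w, m w = 0) :=
  condU1_add (condU1_add (condU1_single (by simp) _) (condU1_single (sum_dfreq u v) _))
    (condU1_single (sum_dfreq v u) _)

/-- `sinTab` is `U(1)` invariant. -/
theorem condU1_sinTab (u v : W 2) : (∀ m ∈ (sinTab u v).support, ∑ w, m w = 0) :=
  condU1_add (condU1_single (sum_dfreq u v) _) (condU1_single (sum_dfreq v u) _)

/-- weighted norm of `cosTab u v` is at most `1 + e²`. -/
theorem normA_cosTab {u v : W 2} (h : u ≠ v) : normA (cosTab u v) ≤ 1 + Real.exp 2 := by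
  have h' : v ≠ u := fun e => h e.symm
  have e0 : normA (Finsupp.single (0 : Freq 2) (1 : ℂ)) = 1 := by
    rw [normA_single]; simp
  have e1 : normA (Finsupp.single (dfreq u v) (-(1/2 : ℂ))) = (1/2) * Real.exp 2 := by
    rw [normA_single, sum_abs_dfreq h]; simp
  have e2 : normA (Finsupp.single (dfreq v u) (-(1/2 : ℂ))) = (1/2) * Real.exp 2 := by
    rw [normA_single, sum_abs_dfreq h']; simp
  have s1 := normA_add_le (Finsupp.single (0 : Freq 2) (1 : ℂ) + Finsupp.single (dfreq u v) (-(1/2 : ℂ)))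
    (Finsupp.single (dfreq v u) (-(1/2 : ℂ)))
  have s2 := normA_add_le (Finsupp.single (0 : Freq 2) (1 : ℂ)) (Finsupp.single (dfreq u v) (-(1/2 : ℂ)))
  unfold cosTab
  linarith

/-- weighted norm of `sinTab u v` is at most `e²`. -/
theorem normA_sinTab {u v : W 2} (h : u ≠ v) : normA (sinTab u v) ≤ Real.exp 2 := by
  have h' : v ≠ u := fun e => h e.symm
  have e1 : normA (Finsupp.single (dfreq u v) (-(Complex.I / 2))) = (1/2) * Real.exp 2 := by
    rw [normA_single, sum_abs_dfreq h]; simp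
  have e2 : normA (Finsupp.single (dfreq v u) (Complex.I / 2)) = (1/2) * Real.exp 2 := by
    rw [normA_single, sum_abs_dfreq h']; simp
  have s1 := normA_add_le (Finsupp.single (dfreq u v) (-(Complex.I / 2)))
    (Finsupp.single (dfreq v u) (Complex.I / 2))
  unfold sinTab
  linarith

/-- a list sum of `cosTab`s is `U(1)` invariant. -/
theorem condU1_map_cosTab (l : List (W 2 × W 2)) :
    (∀ m ∈ ((l.map fun e => cosTab e.1 e.2).sum).support, ∑ w, m w = 0) :=
  condU1_list_sum _ fun c hc => by
    obtain ⟨e, -, rfl⟩ := List.mem_map.1 hc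
    exact condU1_cosTab _ _

/-- a list sum of `sinTab`s is `U(1)` invariant. -/
theorem condU1_map_sinTab (l : List (W 2 × W 2)) :
    (∀ m ∈ ((l.map fun e => sinTab e.1 e.2).sum).support, ∑ w, m w = 0) :=
  condU1_list_sum _ fun c hc => by
    obtain ⟨e, -, rfl⟩ := List.mem_map.1 hc
    exact condU1_sinTab _ _


end

end Summit.HubbardSuperconductivity.BirComplexStableXYNegative
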